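import Summits.QuantumFields.BalabanUV.T4Continuum.Support.MinimalActionLimit
import Literature.MathematicalPhysics.QuantumFieldTheory.Balaban1983to89.B11Thm1
import HarnessLib

/-!
# T⁴ programme, node NE3 (η-rate of the minimisers) — THE DICTIONARY, part 1: B11's variational problem INSTANTIATED over
# the torus objects of the action sandwich (`torusVP`), the faithful-existential reading of the regularity clause (9)–(10),
# and the level-dependent class radius that absorbs B7 Prop. 1's second-order loss

NE3 formalisation swarm of the cell `pub-balaban`, crew item (s3) of the row-owner skeleton
`t4/b2b-balaban-t4-ne3-p1/SKELETON-NE3-P1.md` v1.1 §6 («the concrete `B11.VarProblem` instance over the torus objects +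
`Thm1At ⇒ UpperData`»), leaf seat `b2b-balaban-t4-ne3-formalise-leaf-06`; claim table `t4/formal/NE3/LEAVES.md` row S3.
Part 2 (`MinimalActionFromThm1`) proves the END `Thm1At ⇒ UpperData ⇒ lim A_k(V) exists` from this file.

## What this file does

The owner's sandwich (`MinimalActionLevels` … `MinimalActionLimit`) proves the ACTION half of NE3 and the existence of
`lim_k A_k(V)` from hypothesis STRUCTURES `SandwichData` ∕ `UpperData` over an abstract class family `𝒞`, whose fields
are «B11 Theorem 1 TYPE».  The tree's `B11Thm1.Thm1At C P` is Theorem 1 of [Balaban1985Variational] typed at given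
constants `C` over reader r2's ABSTRACT carrier `P : B11.VarProblem` (primitive fields `Cfg`, `InU`, `InB`,
`OnMinimalOrbit`, `Gauged`, `normA`, …).  Here the carrier is INSTANTIATED (**`torusVP`**, §4): configurations on `ℤ^d`
with values in `U(N)`, periodic of period `N·L^k` (run `k`, spacing `η = L^{−k}`); `InU e U := U ∈ sfClass d L N e k`
(the class (2)∕(6)∕(8)); `InB V U := avgIter L U k = V` (the constraint (3)); `Reg7 e V := V ∈ sfClass d L N e 0`
(hypothesis (7)); `OnMinimalOrbit e V U := IsMinimiser d (sfClass d L N e) L N k V U` (a minimal orbit of (5) in the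
space `𝔘_k(e) ∩ 𝔅_k(V)`); cubes `(y, K) ↦ box K y` of size parameter `M = (2K+1)∕(2L^k)` (`cubeM`); and the regularity
fields by the FAITHFUL-EXISTENTIAL device of §3: for an ABSTRACT local-gauge shape `G U y K α₀ α₁ α₂` («on `box K y`, `U`
is gauge equivalent to `exp a` with `‖a‖ ≤ α₀`, `‖∇a‖ ≤ α₁`, `‖Δa‖ ≤ α₂`» — to be instantiated with row NE3-R2's
`AveragingDeficitKDatum.ExpGauge d` when that module is in the tree), `normA = normGradA = normLapA :=` the infimum `Ψ`
(`gaugeInf`) of the common factors `t ≥ 0` for which `G U y K (t∕L^k) (t∕L^{2k}) (t∕L^{3k})` holds (`gaugeFactors`),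
`Gauged :=` «some such `t` exists»; so r2's `B11.Regularity` (= `Gauged ∧ (9) ∧ (10)`) for the instance says LITERALLY
«there is ONE gauge in which the three printed sup bounds hold with the common factor `B₃Mε₁`»
(**`gauge_of_regularity`**, §5) — no canonical gauge is chosen (owner skeleton §6 risk (r1) answered).

## The one located cost: the radius of the class must depend on the level (§2)

B7 Prop. 1 (51) loses at second order: a configuration with `|U(∂p) − 1| ≤ r η′²` averages to one with
`|Ū(∂p′) − 1| ≤ (r + C₀ r² η²) η²` (**`avgRadius_level`**, exact), never `≤ r η²`.  With ONE radius `B₃ε₁` at all levels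
the upper half of the sandwich ((H4): the averaged level-`(k+1)` minimiser is admissible at level `k`) has NO kernel path
from Theorem 1 read literally.  REPAIR INSIDE THEOREM 1'S OWN QUANTIFIER: Theorem 1 holds «for an arbitrary configuration
`V` satisfying (7) with `ε₁ ≤ a₁`», and a FIXED `V` satisfies (7) with every larger `ε₁′`; part 2 invokes it at level `k`
with `ε₁^{(k)} = ε₁(1 + s_k)`, `s_k = θ^k∕(1 − θ)`, `θ = L^{−2}` (**`levelEps`**), i.e. class radius `B₃ε₁(1 + s_k)`
(**`thm1Radius`**, **`thm1Class`**), and `s_k − s_{k+1} = θ^k` absorbs the loss as soon as `49·C₀·B₃ε₁ ≤ 9`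
(**`radius_step`**).  No uniqueness clause and no «minimum over a larger space» is needed.

## DIVERGENCES from print (cell `DIVERGENCE.md` rows D-s3-1 … D-s3-6 of this seat)

(D-s3-1) the space (2)∕(6)∕(8) (= [Balaban1985RegularSpaces] (1.7)–(1.9)) ↦ the owner's `sfClass` (plaquette condition
at the top level only, which implies the lower-level plaquette conditions; NON-strict `≤`; the CURRENT condition (1.9) is
NOT modelled — owner skeleton §6 (r3)); (D-s3-2) «minimal orbit in the space `𝔘_k(e) ∩ 𝔅_k(V)`» ↦ `IsMinimiser` = a
GLOBAL minimum of (5) over that space (the paper's abstract: «there exists a minimum of this action. The minimum is unique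
up to gauge transformations»; the proof p. 299 argues a local minimum — cell row D-B11-2); (D-s3-3) cubes ↦ ALL lattice
cubes `box K y` with `M = (2K+1)∕(2L^k) ≤ M(ε₁)` (print: cubes aligned with big blocks, `M ∈ R₁M₁ℕ`; any lattice cube
sits in an aligned printed cube two big blocks larger, whose gauge restricts — a shift of `M(ε₁)` by `2R₁M₁`);
(D-s3-4) (9)–(10) ↦ the least common factor `Ψ` of ONE local gauge (`Regularity` ⟺ such a gauge exists); the HÖLDER clause
`‖A‖_{1,β} < B₄Mε₁(L^jη)^{−2−β}` of (9) is NOT modelled (`holderA := 0`: vacuous, the typed theorem is WEAKER than print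
there); (D-s3-5) the UNIQUENESS clause («unique critical orbit in (6)») is NOT modelled (`UniqueCriticalOrbit := True`,
weaker than print; route (A) does not consume it); (D-s3-6) levels: B11's problem index `k` ↦ the sandwich's run `k`
(`η = L^{−k}`, unit torus of side `N`, everywhere-small-field case `Ω_j = T`); the level-`0` class carries the bump
`+ ε₁` so that the datum itself is its level-`0` minimiser.

HONEST FRAMING.  Finite-T⁴ ultraviolet bookkeeping about MINIMISERS (rung (B)+1 of the cell's ladder).  NOTHING of B11 is
asserted: `torusVP` only gives MEANING to r2's primitive fields, and `Thm1At (torusVP …)` is a hypothesis of part 2, B11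
Theorem 1 being the manuscript under audit (ABSOLUTE RULE of the cell); no `sorry`, no axioms beyond Mathlib's; no
conditional of the cell (`BetaPertH`, (B), (B^μ)) occurs; nothing bears on infinite volume, a mass gap, or the Clay
problem; **NE3 is NOT proved**.  PLACEMENT (human rule 2026-08-19): cell work under `Summits/QuantumFields/BalabanUV/`;
imports the accepted `Support.MinimalActionLimit` (p204971∕p205224) and `Literature.…B11Thm1` only; moves nothing.
Context: T. Bałaban, Commun. Math. Phys. **102** (1985) 277–309 [Balaban1985Variational], abstract p. 277, (2)–(8) p. 278,
Thm 1 (8)–(10) p. 279; **98** (1985) 17–51 [Balaban1985Averaging], Prop. 1 (51) p. 26; **99** (1985) 75–102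
[Balaban1985RegularSpaces], (1.7)–(1.9) p. 77.  Records: `t4/formal/NE3/LEAVES.md` row S3, skeleton v1.1 §3 rows
A-H1∕A-H3a∕A-H3b∕A-H4, §6 (s3), §7.
-/

set_option autoImplicit false

open scoped BigOperators Matrix Matrix.Norms.L2Operator Topology
open NormedSpace Finset Filter

namespace Summit.QuantumFields.BalabanUV.T4Continuum.MinimalActionDictionary

open Literature.MathematicalPhysics.QuantumFieldTheory.Balaban1983to89
open B7Prop1Explicit B7Prop2Explicit MatrixLog UnitaryModel
open T4AveragingDeficitWall hiding Site Plane Plaq Bond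
open T4AveragingDeficitWallBoundary (IsPeriodicCfg periodBox)
open MinimalActionLevels MinimalActionSandwich MinimalActionRate MinimalActionLimit
open B11 (VarProblem Regularity)
open B11Thm1 (Thm1At Exists8 Reg910)

noncomputable section

variable {d : ℕ} {n : Type} [Fintype n] [DecidableEq n]


/-! ## §1 Minimisers: the class enters through its level-`k` member; level `0` -/

/-- `IsMinimiser d 𝒞 L N k V U` depends on the family `𝒞` only through `𝒞 k`. [folklore] -/
theorem isMinimiser_congr {𝒞₁ 𝒞₂ : ℕ → Set (Site d → Fin d → (Matrix n n ℂ)ˣ)} {L N k : ℕ} {V U : Site d → Fin d → (Matrix n n ℂ)ˣ}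
    (h : 𝒞₁ k = 𝒞₂ k) : IsMinimiser d 𝒞₁ L N k V U ↔ IsMinimiser d 𝒞₂ L N k V U := by
  have ha : admissible 𝒞₁ L k V = admissible 𝒞₂ L k V := by
    ext W; simp only [admissible, Set.mem_setOf_eq, h]
  constructor
  · rintro ⟨hm, hle⟩
    exact ⟨by rw [← ha]; exact hm, fun U' hU' => hle U' (by rw [ha]; exact hU')⟩
  · rintro ⟨hm, hle⟩
    exact ⟨by rw [ha]; exact hm, fun U' hU' => hle U' (by rw [← ha]; exact hU')⟩

/-- At level `0` the admissible set is `{V} ∩ 𝒞 0` (the `0`-fold average (43) is the identity), so the datum is a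
minimiser of run `0` as soon as it lies in the class. [folklore] -/
theorem isMinimiser_zero {𝒞 : ℕ → Set (Site d → Fin d → (Matrix n n ℂ)ˣ)} {L N : ℕ} {V : Site d → Fin d → (Matrix n n ℂ)ˣ} (hV : V ∈ 𝒞 0) :
    IsMinimiser d 𝒞 L N 0 V V where
  mem := ⟨hV, rfl⟩
  le := fun U' hU' => by
    have h : U' = V := hU'.2
    rw [h]

/-- The small-field class is monotone in its radius. [folklore] -/
theorem sfClass_mono {L N k : ℕ} {ε ε' : ℝ} (h : ε ≤ ε') : sfClass d L N ε k ⊆ sfClass (n := n) d L N ε' k := by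
  rintro U ⟨hu, hp, hs⟩
  exact ⟨hu, hp, SmallField.mono hs (div_le_div_of_nonneg_right h (by positivity))⟩

/-! ## §2 The level-dependent radius: Theorem 1 at `ε₁^{(k)} = ε₁(1 + s_k)` absorbs B7 Prop. 1's second-order loss -/

/-- The geometric tail `s_k = θ^k∕(1 − θ)`, `θ = L^{−2}`. [folklore] -/
def tailSum (L k : ℕ) : ℝ := (((L : ℝ) ^ 2)⁻¹) ^ k / (1 - ((L : ℝ) ^ 2)⁻¹)

/-- `0 ≤ θ ≤ 1∕4` for `L ≥ 2`. [folklore] -/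
theorem theta_bounds {L : ℕ} (hL : 2 ≤ L) : 0 ≤ ((L : ℝ) ^ 2)⁻¹ ∧ ((L : ℝ) ^ 2)⁻¹ ≤ 1 / 4 := by
  have hL2 : (2 : ℝ) ≤ L := by exact_mod_cast hL
  have h4 : (4 : ℝ) ≤ (L : ℝ) ^ 2 := by nlinarith
  refine ⟨by positivity, ?_⟩
  rw [one_div]
  exact inv_anti₀ (by norm_num) h4

/-- `0 ≤ s_k`. [folklore] -/
theorem tailSum_nonneg {L : ℕ} (hL : 2 ≤ L) (k : ℕ) : 0 ≤ tailSum L k := by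
  obtain ⟨h0, h4⟩ := theta_bounds hL
  unfold tailSum
  exact div_nonneg (pow_nonneg h0 k) (by linarith)

/-- `s_k ≤ 4∕3`. [folklore] -/
theorem tailSum_le {L : ℕ} (hL : 2 ≤ L) (k : ℕ) : tailSum L k ≤ 4 / 3 := by
  obtain ⟨h0, h4⟩ := theta_bounds hL
  unfold tailSum
  have h1 : (((L : ℝ) ^ 2)⁻¹) ^ k ≤ 1 := pow_le_one₀ h0 (by linarith)
  rw [div_le_iff₀ (by linarith)]
  linarith

/-- The telescoping step `s_k = s_{k+1} + θ^k`. [folklore] -/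
theorem tailSum_succ_add {L : ℕ} (hL : 2 ≤ L) (k : ℕ) :
    tailSum L (k + 1) + (((L : ℝ) ^ 2)⁻¹) ^ k = tailSum L k := by
  obtain ⟨h0, h4⟩ := theta_bounds hL
  unfold tailSum
  generalize ((L : ℝ) ^ 2)⁻¹ = θ at h0 h4 ⊢
  have h1 : (1 : ℝ) - θ ≠ 0 := by linarith
  rw [pow_succ]
  field_simp
  ring

/-- `s_{k+1} ≤ s_k`. [folklore] -/
theorem tailSum_succ_le {L : ℕ} (hL : 2 ≤ L) (k : ℕ) : tailSum L (k + 1) ≤ tailSum L k := by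
  have := tailSum_succ_add hL k
  have h0 := pow_nonneg (theta_bounds hL).1 k
  linarith

/-- `s_k ≤ s_0`, i.e. `s` is antitone. [folklore] -/
theorem tailSum_le_zero {L : ℕ} (hL : 2 ≤ L) : ∀ k : ℕ, tailSum L k ≤ tailSum L 0
  | 0 => le_rfl
  | k + 1 => (tailSum_succ_le hL k).trans (tailSum_le_zero hL k)

/-- **THE LEVEL-`k` PARAMETER `ε₁^{(k)} = ε₁(1 + s_k)`** at which Theorem 1 is invoked for the level-`k` problem (a fixed
datum `V` with (7) at `ε₁` satisfies (7) at every `ε₁′ ≥ ε₁`). [folklore] -/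
def levelEps (ε₁ : ℝ) (L k : ℕ) : ℝ := ε₁ * (1 + tailSum L k)

/-- `ε₁ ≤ ε₁^{(k)}`. [folklore] -/
theorem le_levelEps {L : ℕ} (hL : 2 ≤ L) {ε₁ : ℝ} (hε : 0 ≤ ε₁) (k : ℕ) : ε₁ ≤ levelEps ε₁ L k := by
  unfold levelEps
  have := tailSum_nonneg hL k
  nlinarith

/-- `ε₁^{(k)} ≤ (7∕3)ε₁`. [folklore] -/
theorem levelEps_le {L : ℕ} (hL : 2 ≤ L) {ε₁ : ℝ} (hε : 0 ≤ ε₁) (k : ℕ) : levelEps ε₁ L k ≤ 7 / 3 * ε₁ := by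
  unfold levelEps
  have := tailSum_le hL k
  nlinarith

/-- `ε₁^{(k+1)} ≤ ε₁^{(k)}`. [folklore] -/
theorem levelEps_succ_le {L : ℕ} (hL : 2 ≤ L) {ε₁ : ℝ} (hε : 0 ≤ ε₁) (k : ℕ) :
    levelEps ε₁ L (k + 1) ≤ levelEps ε₁ L k := by
  unfold levelEps
  have := tailSum_succ_le hL k
  nlinarith

/-- **THE CLASS RADIUS AT LEVEL `k`**: `B₃ ε₁^{(k)}` for `k ≥ 1` (the space (8) of Theorem 1 at `ε₁^{(k)}`); at level `0`
the bump `+ ε₁` makes the datum (plaquettes `≤ ε₁`) a member whatever `B₃` is. [folklore] -/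
def thm1Radius (C : B11Thm1.Consts) (ε₁ : ℝ) (L : ℕ) : ℕ → ℝ
  | 0 => C.B₃ * levelEps ε₁ L 0 + ε₁
  | k + 1 => C.B₃ * levelEps ε₁ L (k + 1)

variable (d) in
/-- **THE CLASS FAMILY OF THE DICTIONARY**: run `k` minimises over `sfClass d L N (thm1Radius C ε₁ L k) k`. [folklore] -/
def thm1Class (L N : ℕ) (C : B11Thm1.Consts) (ε₁ : ℝ) : ℕ → Set (Site d → Fin d → (Matrix n n ℂ)ˣ) :=
  fun k => sfClass d L N (thm1Radius C ε₁ L k) k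

/-- `B₃ ε₁^{(k)} ≤ thm1Radius C ε₁ L k`. [folklore] -/
theorem radius_le_thm1Radius (C : B11Thm1.Consts) {ε₁ : ℝ} (hε : 0 ≤ ε₁) (L : ℕ) :
    ∀ k : ℕ, C.B₃ * levelEps ε₁ L k ≤ thm1Radius C ε₁ L k
  | 0 => by simp only [thm1Radius]; linarith
  | _ + 1 => le_rfl

/-- B7's second-order constant `C₀(d) = 226·(8(d+1)(d+4))²` (as in the tree's `avgRadius`). [folklore] -/
def lossConst (d : ℕ) : ℝ := 226 * (8 * ((d : ℝ) + 1) * (d + 4)) ^ 2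

/-- **THE EXACT RADIUS AFTER ONE AVERAGING STEP**, keeping the extra `η² = θ^k` of the second-order term:
`avgRadius d L (r∕(L^{k+1})²) = (r + C₀ r² θ^k)∕(L^k)²`. [cite: Balaban1985Averaging, Prop. 1 (51) p.26] -/
theorem avgRadius_level {L : ℕ} (hL : 1 ≤ L) (r : ℝ) (k : ℕ) :
    avgRadius d L (r / ((L : ℝ) ^ (k + 1)) ^ 2)
      = (r + lossConst d * r ^ 2 * (((L : ℝ) ^ 2)⁻¹) ^ k) / ((L : ℝ) ^ k) ^ 2 := by
  have hL0 : (L : ℝ) ≠ 0 := by exact_mod_cast (by omega : L ≠ 0)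
  unfold avgRadius lossConst
  rw [inv_pow, ← pow_mul, pow_succ]
  field_simp
  ring

/-- **THE RADIUS STEP**: `r_{k+1} + C₀ r_{k+1}² θ^k ≤ r_k` for `r_k = e(1 + s_k)`, as soon as `(49∕9)·C₀·e ≤ 1`
(`r_k − r_{k+1} = eθ^k` and `C₀ r_{k+1}² ≤ C₀ (7e∕3)² ≤ e`). [folklore] -/
theorem radius_step {L : ℕ} (hL : 2 ≤ L) {e : ℝ} (he : 0 ≤ e) (hC : lossConst d * e * 49 ≤ 9) (k : ℕ) :
    e * (1 + tailSum L (k + 1)) + lossConst d * (e * (1 + tailSum L (k + 1))) ^ 2 * (((L : ℝ) ^ 2)⁻¹) ^ k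
      ≤ e * (1 + tailSum L k) := by
  have hθ := pow_nonneg (theta_bounds hL).1 k
  have hs0 := tailSum_nonneg hL (k + 1)
  have hs1 := tailSum_le hL (k + 1)
  have hC0 : 0 ≤ lossConst d := by unfold lossConst; positivity
  rw [← tailSum_succ_add hL k]
  -- it suffices: `C₀ (e(1+s))² ≤ e`
  have hkey : lossConst d * (e * (1 + tailSum L (k + 1))) ^ 2 ≤ e := by
    have h73 : e * (1 + tailSum L (k + 1)) ≤ 7 / 3 * e := by nlinarith
    have h0 : 0 ≤ e * (1 + tailSum L (k + 1)) := by positivity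
    calc lossConst d * (e * (1 + tailSum L (k + 1))) ^ 2 ≤ lossConst d * (7 / 3 * e) ^ 2 := by
          gcongr
      _ = (lossConst d * e * 49 / 9) * e := by ring
      _ ≤ 1 * e := by gcongr; linarith
      _ = e := one_mul e
  nlinarith

/-! ## §3 The faithful-existential regularity device over an abstract local-gauge shape `G` -/

variable (d) in
/-- Monotonicity of a local-gauge shape in its three radii (bigger radii = weaker statement). [folklore] -/
@[folklore]
def RadiiMono (G : (Site d → Fin d → (Matrix n n ℂ)ˣ) → Site d → ℕ → ℝ → ℝ → ℝ → Prop) : Prop :=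
  ∀ (U : Site d → Fin d → (Matrix n n ℂ)ˣ) (y : Site d) (K : ℕ) (a₀ a₁ a₂ b₀ b₁ b₂ : ℝ),
    a₀ ≤ b₀ → a₁ ≤ b₁ → a₂ ≤ b₂ → G U y K a₀ a₁ a₂ → G U y K b₀ b₁ b₂

/-- **THE ADMISSIBLE COMMON FACTORS** of a local gauge on the cube `box K y` at level `k`: the `t ≥ 0` for which the shape
holds with the lattice radii `(t∕L^k, t∕L^{2k}, t∕L^{3k})` — print's `|A| < t(L^jη)⁻¹`, `|∇^ηA| < t(L^jη)⁻²`,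
`|Δ^ηA| < t(L^jη)⁻³` for `U = e^{iηA}`, `η = L^{−k}`, `L^jη = 1`, read for the lattice potential `a = ηA`. [folklore] -/
def gaugeFactors (G : (Site d → Fin d → (Matrix n n ℂ)ˣ) → Site d → ℕ → ℝ → ℝ → ℝ → Prop) (L k : ℕ)
    (U : Site d → Fin d → (Matrix n n ℂ)ˣ) (y : Site d) (K : ℕ) : Set ℝ :=
  {t | 0 ≤ t ∧ G U y K (t / (L : ℝ) ^ k) (t / ((L : ℝ) ^ k) ^ 2) (t / ((L : ℝ) ^ k) ^ 3)}

/-- **`Ψ`**: the least admissible common factor (an honest real infimum; `0` when no gauge exists, which `Gauged` rules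
out). [folklore] -/
def gaugeInf (G : (Site d → Fin d → (Matrix n n ℂ)ˣ) → Site d → ℕ → ℝ → ℝ → ℝ → Prop) (L k : ℕ)
    (U : Site d → Fin d → (Matrix n n ℂ)ˣ) (y : Site d) (K : ℕ) : ℝ :=
  sInf (gaugeFactors G L k U y K)

/-- The size parameter `M` of the lattice cube `box K y` at level `k`: side `(2K+1)` sites `= 2M·L^k` (print: «a cube □ …
of a size `2ML^jη`», `L^jη = 1` at the top level). [cite: Balaban1985Variational, Thm 1 p.279] -/
def cubeM (L k K : ℕ) : ℝ := (2 * (K : ℝ) + 1) / (2 * (L : ℝ) ^ k)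

/-- `0 < M`. [folklore] -/
theorem cubeM_pos {L : ℕ} (hL : 1 ≤ L) (k K : ℕ) : 0 < cubeM L k K := by
  have hL0 : (0 : ℝ) < L := by exact_mod_cast (by omega : 0 < L)
  unfold cubeM; positivity

/-- The cube of the `ℓ²` gradient slot (block `L^k•q`, collar `L^k`, two boundary layers: `K = L^k − 1 + L^k + 2`) has
`M ≤ 7∕2`. [folklore] -/
theorem cubeM_slot_le {L : ℕ} (hL : 1 ≤ L) (k : ℕ) : cubeM L k (L ^ k - 1 + L ^ k + 2) ≤ 7 / 2 := by
  have h1 : 1 ≤ L ^ k := Nat.one_le_pow _ _ hL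
  have hK : ((L ^ k - 1 + L ^ k + 2 : ℕ) : ℝ) = 2 * (L : ℝ) ^ k + 1 := by
    have : L ^ k - 1 + L ^ k + 2 = 2 * L ^ k + 1 := by omega
    rw [this]; push_cast; ring
  have hLk : (1 : ℝ) ≤ (L : ℝ) ^ k := by exact_mod_cast h1
  unfold cubeM
  rw [hK, div_le_iff₀ (by positivity)]
  nlinarith

/-! ## §4 THE INSTANCE: B11's variational problem over the torus objects of the sandwich -/

variable (d) in
/-- **THE TORUS INSTANCE OF r2's CARRIER `B11.VarProblem` AT LEVEL `k`** (dictionary of the module header; divergences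
D-s3-1 … D-s3-6 there).  `Cfg = Bdry =` configurations on `ℤ^d`; `InU e` = the class `sfClass d L N e k` ((2)∕(6)∕(8):
`U(N)`-valued, `(N·L^k)`-periodic, `|U(∂p) − 1| ≤ e η²`, `η = L^{−k}`); `InB V U` = «`Ū^k = V`» (3); `Reg7 e V` = «`V`
unitary, `N`-periodic, `|V(∂p′) − 1| ≤ e`» (7); `OnMinimalOrbit e V U` = «`U` minimises (5) over `𝔘_k(e) ∩ 𝔅_k(V)` and
lies in it»; cubes `(y, K) ↦ box K y`, `scale = k`, `sizeM = (2K+1)∕(2L^k)`, `eta = L^{−k}`; regularity fields = `Ψ`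
(§3) for all three norms, `Gauged` = a local gauge exists, `holderA = 0` and `UniqueCriticalOrbit = True` NOT modelled
(weaker than print). [cite: Balaban1985Variational, (2)–(8) p.278, Thm 1 (8)–(10) p.279] -/
def torusVP (L N : ℕ) (G : (Site d → Fin d → (Matrix n n ℂ)ˣ) → Site d → ℕ → ℝ → ℝ → ℝ → Prop) (k : ℕ) : VarProblem where
  Cfg := Site d → Fin d → (Matrix n n ℂ)ˣ
  Bdry := Site d → Fin d → (Matrix n n ℂ)ˣ
  Cube := Site d × ℕ
  scale := fun _ => k
  sizeM := fun c => cubeM L k c.2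
  eta := ((L : ℝ) ^ k)⁻¹
  L := L
  InU := fun e U => U ∈ sfClass d L N e k
  InB := fun V U => avgIter L U k = V
  Reg7 := fun e V => V ∈ sfClass d L N e 0
  OnMinimalOrbit := fun e V U => IsMinimiser d (sfClass d L N e) L N k V U
  UniqueCriticalOrbit := fun _ _ _ => True
  Gauged := fun U c => (gaugeFactors G L k U c.1 c.2).Nonempty
  normA := fun U c => gaugeInf G L k U c.1 c.2
  normGradA := fun U c => gaugeInf G L k U c.1 c.2
  holderA := fun _ _ _ => 0
  normLapA := fun U c => gaugeInf G L k U c.1 c.2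

/-! ## §5 `Regularity` for the instance = ONE local gauge with the three printed sup bounds -/

/-- **EXTRACTION**: r2's `B11.Regularity` ((9) ∧ (10) in some gauge) for the torus instance at the cube `(y, K)` yields the
shape `G` on `box K y` with the lattice radii `(c∕L^k, c∕L^{2k}, c∕L^{3k})` for every `c ≥ B₃·M·ε` — the printed common
factor `B₃Mε₁` (strict infimum ⇒ a witness below the bound; monotonicity of `G`). [folklore] -/
theorem gauge_of_regularity {G : (Site d → Fin d → (Matrix n n ℂ)ˣ) → Site d → ℕ → ℝ → ℝ → ℝ → Prop} (hG : RadiiMono d G)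
    {L N k : ℕ} (hL : 1 ≤ L) {B₃ B₄ ε c : ℝ}
    {U : Site d → Fin d → (Matrix n n ℂ)ˣ} {y : Site d} {K : ℕ}
    (hreg : Regularity (torusVP d L N G k) B₃ B₄ ε U (y, K)) (hc : B₃ * cubeM L k K * ε ≤ c) :
    G U y K (c / (L : ℝ) ^ k) (c / ((L : ℝ) ^ k) ^ 2) (c / ((L : ℝ) ^ k) ^ 3) := by
  obtain ⟨hne, h9, -, -, -⟩ := hreg
  have hL0 : (L : ℝ) ^ k ≠ 0 := pow_ne_zero _ (by exact_mod_cast (by omega : L ≠ 0))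
  have hfac : ((L : ℝ) ^ k * ((L : ℝ) ^ k)⁻¹)⁻¹ ^ 1 = 1 := by
    rw [mul_inv_cancel₀ hL0, inv_one, one_pow]
  have h9' : gaugeInf G L k U y K < B₃ * cubeM L k K * ε := by
    have := h9
    dsimp only [torusVP] at this
    rwa [hfac, mul_one] at this
  obtain ⟨t, ⟨ht0, htG⟩, htlt⟩ := exists_lt_of_csInf_lt hne h9'
  have htc : t ≤ c := (htlt.le).trans hc
  have hLk : (0 : ℝ) < (L : ℝ) ^ k := by positivity
  exact hG U y K _ _ _ _ _ _ (div_le_div_of_nonneg_right htc hLk.le)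
    (div_le_div_of_nonneg_right htc (by positivity)) (div_le_div_of_nonneg_right htc (by positivity)) htG

end

end Summit.QuantumFields.BalabanUV.T4Continuum.MinimalActionDictionary
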